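/-
Copyright (c) 2026 the pub-hodgecm-mathlib formalisation cell (harness21).  Prover seat hodgecm-mathlib-LH4-p15 (g0), req620 Track A «(D-RAM) FOUR-FRAME» squad
(STAGE-1b, row (2) of the piece `f_{T₊}`, the (β₂) road; director s1968 EMIT «β₂ specific-cell class (M3)»; dealer∕pen LH4-plan (g13) WORD #119 «THE β₂ FACE ON AXIS
CELLS (M3)»; face owner LH4-p09 (g9) CLASS-A FACE RECIPE 14:47:36Z; (S4) consumer LH4-p04 (g8)), 2026-09-04.
-/
import Summits.HodgeConjecture.HodgeConjecture.Theorems.F0P3cDyRamValueSetTwoClassObstruction  -- ★ p13 (L-lab-9): `exists_norm_of_mem_valueSetMod_smul_xPlus`, `smul_refSkewScalar_mem_valueSetMod_smul_xPlus`; brings ★ (L-lab-3) `valueSetMod_smul_xPlus`, ★ `valueSetMod_smul_xPlus_mul_norm`, ★ census DEFS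
import Summits.HodgeConjecture.HodgeConjecture.Theorems.F0P3cDyRamGlueLabelPlaneScaling         -- ★ p861069 (LH4-p09 (g9)) «PLANE SCALING»: `latticeValueSetMod_glued_map_eq_image_mul`
import Summits.HodgeConjecture.HodgeConjecture.Theorems.F0P3cDyRamConeCellFlipUnits             -- ★ (LH4-p11 (g8)) §B heads; brings ★ p860839 `…ConeCellFlipBalance` (flip cell-preservation ∕ exchange), ★ `isNorm_iff_not_isNorm_div`, ★ DEFS `levelSet ∕ levelSetDep`
import Literature.NumberTheory.LocalFields.ValuedCompleteIsAdicComplete                          -- ★ `isAdicComplete_valuedInteger_of_completeSpace`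
import HarnessLib

/-!
# Crux `H413`, line LH4 «(D-RAM) FOUR-FRAME» — STAGE-1b, row (2), the (β₂) road, brick (β₂-H) class (M3): «THE β₂ FACE ON AXIS CELLS» — under a cell symmetry that
# multiplies the census value set by a `σ`-fixed NON-NORM unit `ξ`, the transvection label `+` becomes `−′` and `−′` becomes `+`; hence `#{+} = #{−′}` on the cell

Cell `hodgecm-mathlib` (D-0151), FLOOR 0, crux item H413 = `stmt-HodgeConjecture-24833`, route of record `HCCMUnconditional`; squad F0∕P3c∕LH4; lane
`--supports stmt-HodgeConjecture-24833 --as helper` (count-neutral; pays NO tier-0 row).  THEOREMS ONLY (no `def`, no instance, no notation, no `sorry`, default heartbeats);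
★-only imports; states NO law; (β₂) stays a HYPOTHESIS.

THE MATHEMATICS (LH4-p09 (g9) MECH-beta2H v1 c3af1df2 (M3) + CLASS-A FACE RECIPE 14:47:36Z; F0P3-p01 (g36) TORUS-FLIP ∕ ORBIT-SCAN: on the ω-cells — the AXIS cells `(7,0)@ℚ₂(√2)`,
`(8,0)@ℚ₂(i)` among them, `16+16` each — `label(ε·Λ₀) = ω(N_Θ ε)·label(Λ₀)`).  (β₂-H) on a SPECIFIC cell is ★ p860839: a cell-preserving symmetry exchanging the two label classes
gives `#{+} = #{−′}`.  On an axis cell the symmetry is the flip `Λ ↦ ε • Λ` of the line model (`ε·Θε = ξ` a `ρ`-fixed unit: cell preservation ★ p860839; existence with `ξ` a `σ`-fixed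
NON-norm of `E` ★ `exists_flipUnit_of_forall_fixed_fixed_isNorm`); on the plane it is a `γ₂`-commuting similitude of multiplier `ξ`, which MULTIPLIES THE CENSUS VALUE SET of the
(plane-dominated) vertex BY `ξ` (★ p861069).  THIS FILE supplies the missing implication «value set multiplied by a fixed non-norm unit ⇒ label class exchanged» and composes:
* §1 (K-letters, ★ №3 `valueSetMod ∕ xPlus`): `(ξ·) '' valueSetMod σ ϖ m (e • X₊) = valueSetMod σ ϖ m ((ξe) • X₊)` (`|ξ| = 1`, every `m`); the class dictionary at the level of
  record `m* = mstarOfRecord d`: `valueSetMod σ ϖ m* (e • X₊) = valueSetMod σ ϖ m* (e′ • X₊) ↔ e∕e′ ∈ N(Eˣ)` for `σ`-fixed units (★ p13 obstruction ⊕ ★ `…_mul_norm`).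
* §2 THE FACE at the value-set level, EXCHANGE FORM — for `σ`-fixed NON-norm units `ξ` (multiplier) and `c` (the `−′` representative) and ANY `S ⊆ K`:
  `S = valueSetMod σ ϖ m X₊ → (ξ·) '' S = valueSetMod σ ϖ m (c • X₊)` and `S = valueSetMod σ ϖ m (c • X₊) → (ξ·) '' S = valueSetMod σ ϖ m X₊` — EVERY level `m`, NO dichotomy
  (index two on the fixed line, ★ `isNorm_iff_not_isNorm_div`); the one-label form `(ξ·) '' S = VS(X₊) ↔ ¬ S = VS(X₊)` at `m*` given an (A″) witness `S = valueSetMod σ ϖ m* (e • X₊)`.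
* §3 LATTICE letters (★ census DEFS `latticeValueSetMod ∕ LatticeLabelPlus`): the same for two vertices `M, M′` with `latticeValueSetMod σ ϖ m M′ X′ = (ξ·) '' latticeValueSetMod σ ϖ m M X`,
  and the GLUE-LETTER instance over ★ p861069 (two plane-dominated glued vertices over `(B₂, w₀)` and `(ε·B₂, ε·w₀)`).
* §4 M-letters (★ DEFS `levelSet ∕ levelSetDep`): the `hface` of ★ `F0P3cDyRamConeCellFlipUnits` §B DISCHARGED in exchange form from a value-set dictionary
  `vs : AddSubgroup M → Set E` with `vs (ε • Λ) = (ξ·) '' vs Λ` on the cell; HEADS `#{Λ ∈ levelSetDep … ∣ +} = #{… ∣ −′}` (★ p860839 `…_flip_exchange`) and — the AXIS cells `b = 0`,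
  in the (S4-OF-axis) shape of ★ `…WSideOrderCensusLabelled` — `(levelSet … j a ∩ {+}).ncard = (levelSet … j a ∩ {−′}).ncard`, also with the ω-flip's existence built in.
WITH THE (S4) CONSUMER (LH4-p04 (g8)): the instance `vs Λ := latticeValueSetMod σ ϖ m* (vertex over Λ) (Γ − 1)` and its scaling law from ★ p861069 through ★ (C) `B ↦ φ(B)`
(multiplication by `ε` is a `γ₂`-commuting similitude of multiplier `ξ` by ★ (C1) `hform`); populatedness is automatic at `b = 0`.  NOT CLAIMED: TORUS-FLIP classes B–D.
HONEST LABEL.  Count-neutral set ∕ lattice ∕ norm-class algebra; nothing printed is asserted; no census law is stated; `HC_CM` is proved only modulo the 7 printed citations (2 remaining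
named inputs: hLiu418 = `stmt-HodgeConjecture-24832`, h413 = `stmt-HodgeConjecture-24833`) until rung 0 closes.
## References
* [Serre1979] J.-P. Serre, *Local Fields*, GTM 67 (1979): Ch. V §3 Prop. 5, Cor. 3 pp. 85–87 (norm classes of units of a ramified quadratic extension: index two, conductor).
* [LabesseLanglands1979] J.-P. Labesse, R. P. Langlands, *L-indistinguishability for SL(2)*, Canad. J. Math. 31 (1979), §2 p. 8 (the norm-residue dichotomy).
* [Rogawski1990] J. D. Rogawski, *Automorphic Representations of Unitary Groups in Three Variables*, Ann. of Math. Stud. 123 (1990): §4.9 Prop. 4.9.1 (b) p. 55 (the labelled census of `f_{T₊}`).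
* [Jacobowitz1962] R. Jacobowitz, *Hermitian forms over local fields*, Amer. J. Math. 84 (1962): §4 (similitudes, dual lattices, gluing).
* [Kottwitz1986BaseChangeUnits] R. E. Kottwitz, *Base change for unit elements of Hecke algebras*, Compositio Math. 60 (1986): §1 pp. 240–241.
-/

set_option autoImplicit false

noncomputable section

namespace Summit.HodgeConjecture.HodgeConjecture.Cruxes.H413.F0P3cDyRamConeCellFaceAxis

open scoped Valued WithZero Matrix MatrixGroups Pointwise
open WithZero
open Literature.NumberTheory.Automorphic Literature.NumberTheory.Automorphic.HermitianLattice Literature.NumberTheory.Automorphic.UnitaryLatticeTree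
open Literature.NumberTheory.Automorphic.UnitaryThreeFourFrame (IsRamifiedQuadraticDatum)
open Literature.NumberTheory.Rogawski1990
open Literature.NumberTheory.LocalFields.WildQuadraticDatum (v_eq_one_of_v_mul_map_eq_one)
open Summit.HodgeConjecture.HodgeConjecture.Cruxes.H413.F0P3cDyRamFourFramePieces
open Summit.HodgeConjecture.HodgeConjecture.Cruxes.H413.F0P3cDyRamFourFrameCensusDefs (latticeValueSetMod LatticeLabelPlus)
open Summit.HodgeConjecture.HodgeConjecture.Cruxes.H413.F0P3cDyRamSmulXPlusLabel (valueSetMod_smul_xPlus)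
open Summit.HodgeConjecture.HodgeConjecture.Cruxes.H413.F0P3cDyRamFrameEltOneSlotLabel (valueSetMod_smul_xPlus_mul_norm)
open Summit.HodgeConjecture.HodgeConjecture.Cruxes.H413.F0P3cDyRamValueSetTwoClassObstruction (exists_norm_of_mem_valueSetMod_smul_xPlus smul_refSkewScalar_mem_valueSetMod_smul_xPlus)
open Summit.HodgeConjecture.HodgeConjecture.Cruxes.H413.F0P3cDyRamConeWeightHalfSplit (isNorm_iff_not_isNorm_div)
open Summit.HodgeConjecture.HodgeConjecture.Cruxes.H413.F0P3cDyRamToricCensusDefs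
open Summit.HodgeConjecture.HodgeConjecture.Cruxes.H413.F0P3cDyRamConeCellLabelBalance (ncard_sep_eq_ncard_sep_of_equiv)
open Summit.HodgeConjecture.HodgeConjecture.Cruxes.H413.F0P3cDyRamConeCellFlipBalance

/-! ## §1 K-letters: multiplying the value set of `e • X₊` by a unit `ξ` gives that of `(ξe) • X₊`; the class dictionary at the level of record -/

section Scalar

variable {K : Type} [Field K] [Valued K ℤᵐ⁰]

/-- **`(ξ·) '' valueSetMod σ ϖ m (e • X₊) = valueSetMod σ ϖ m ((ξ·e) • X₊)`** for a unit `ξ` (every level `m`, any `σ`): in ★ (L-lab-3)'s letter the members are the `z` with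
`|(ϖ^m)⁻¹(z − e·t₊·N(a))| ≤ 1`, and `|(ϖ^m)⁻¹(ξz − ξe·t₊·N(a))| = |(ϖ^m)⁻¹(z − e·t₊·N(a))|`. [cite: Rogawski1990, §4.9 Prop. 4.9.1 (b) p. 55] -/
theorem image_mul_valueSetMod_smul_xPlus (σ : K →+* K) (ϖ : K) (d m : ℕ) (e : K) {ξ : K} (hξ1 : Valued.v ξ = 1) :
    (fun z => ξ * z) '' valueSetMod σ ϖ m (e • xPlus σ ϖ d) = valueSetMod σ ϖ m ((ξ * e) • xPlus σ ϖ d) := by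
  have hξ0 : ξ ≠ 0 := fun h0 => by rw [h0, map_zero] at hξ1; exact zero_ne_one hξ1
  have hth : ∀ x : K, Valued.v ((ϖ ^ m)⁻¹ * (ξ * x)) = Valued.v ((ϖ ^ m)⁻¹ * x) := fun x => by
    rw [mul_left_comm, map_mul, hξ1, one_mul]
  ext z
  rw [valueSetMod_smul_xPlus, valueSetMod_smul_xPlus]
  simp only [Set.mem_image, Set.mem_setOf_eq]
  constructor
  · rintro ⟨z', ⟨a, ha, hz'⟩, rfl⟩
    refine ⟨a, ha, ?_⟩
    rw [show ξ * z' - ξ * e * ((ϖ - σ ϖ) * ((ϖ * σ ϖ) ^ ((d - d % 2) / 2))⁻¹ * (a * σ a)) =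
        ξ * (z' - e * ((ϖ - σ ϖ) * ((ϖ * σ ϖ) ^ ((d - d % 2) / 2))⁻¹ * (a * σ a))) by ring, hth]
    exact hz'
  · rintro ⟨a, ha, hz⟩
    refine ⟨ξ⁻¹ * z, ⟨a, ha, ?_⟩, mul_inv_cancel_left₀ hξ0 z⟩
    rw [← hth, show ξ * (ξ⁻¹ * z - e * ((ϖ - σ ϖ) * ((ϖ * σ ϖ) ^ ((d - d % 2) / 2))⁻¹ * (a * σ a))) =
        z - ξ * e * ((ϖ - σ ϖ) * ((ϖ * σ ϖ) ^ ((d - d % 2) / 2))⁻¹ * (a * σ a)) by rw [mul_sub, mul_inv_cancel_left₀ hξ0]; ring]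
    exact hz

/-- **NORM-CLASS INVARIANCE, QUOTIENT FORM**: for units `e, e′` with `e∕e′ = z·σz` a norm, `valueSetMod σ ϖ m (e • X₊) = valueSetMod σ ϖ m (e′ • X₊)` (every `m`; `σ` isometric
makes `z` a unit, then ★ `valueSetMod_smul_xPlus_mul_norm`). [cite: Serre1979, Ch. V §3 Cor. 3] -/
theorem valueSetMod_smul_xPlus_eq_of_exists_norm {σ : K →+* K} (hvσ : ∀ a, Valued.v (σ a) = Valued.v a) (ϖ : K) (d m : ℕ)
    {e e' : K} (he1 : Valued.v e = 1) (he'1 : Valued.v e' = 1) (h : ∃ z : K, z * σ z = e * e'⁻¹) :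
    valueSetMod σ ϖ m (e • xPlus σ ϖ d) = valueSetMod σ ϖ m (e' • xPlus σ ϖ d) := by
  obtain ⟨z, hz⟩ := h
  have he'0 : e' ≠ 0 := fun h0 => by rw [h0, map_zero] at he'1; exact zero_ne_one he'1
  have hz1 : Valued.v z = 1 :=
    v_eq_one_of_v_mul_map_eq_one hvσ (by rw [hz, map_mul, map_inv₀, he1, he'1, inv_one, mul_one])
  have hee : e = e' * (z * σ z) := by rw [hz, mul_comm, inv_mul_cancel_right₀ he'0]
  rw [hee, valueSetMod_smul_xPlus_mul_norm σ ϖ d m e' hz1]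

/-- **THE CLASS DICTIONARY AT THE LEVEL OF RECORD**: at a complete sheet datum `IsRamifiedQuadraticDatum σ ϖ d t`, for `σ`-FIXED units `e, e′`:
`valueSetMod σ ϖ m* (e • X₊) = valueSetMod σ ϖ m* (e′ • X₊) ↔ e∕e′ ∈ N(Eˣ)` (`m* = mstarOfRecord d = d % 2 + 2d − 1`; `→` is ★ p13's obstruction at the member `e·t₊`, `←` is the
norm invariance). [cite: Serre1979, Ch. V §3 Cor. 3] [cite: Rogawski1990, §4.9 Prop. 4.9.1 (b) p. 55] -/
theorem valueSetMod_smul_xPlus_eq_iff_exists_norm [IsAdicComplete 𝓂[K] 𝒪[K]] {σ : K →+* K} {ϖ : K} {d t : ℕ} (hD : IsRamifiedQuadraticDatum σ ϖ d t)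
    {e e' : K} (hσe : σ e = e) (he1 : Valued.v e = 1) (hσe' : σ e' = e') (he'1 : Valued.v e' = 1) :
    valueSetMod σ ϖ (mstarOfRecord d) (e • xPlus σ ϖ d) = valueSetMod σ ϖ (mstarOfRecord d) (e' • xPlus σ ϖ d) ↔ ∃ z : K, z * σ z = e * e'⁻¹ := by
  refine ⟨fun hEq => ?_, valueSetMod_smul_xPlus_eq_of_exists_norm hD.2.1 ϖ d _ he1 he'1⟩
  have hmem := smul_refSkewScalar_mem_valueSetMod_smul_xPlus σ ϖ d (mstarOfRecord d) e
  rw [hEq] at hmem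
  exact exists_norm_of_mem_valueSetMod_smul_xPlus hD hσe he1 hσe' he'1 hmem

/-- `(ξ·) '' valueSetMod σ ϖ m X₊ = valueSetMod σ ϖ m (ξ • X₊)` (the case `e = 1` of `image_mul_valueSetMod_smul_xPlus`). [cite: Rogawski1990, §4.9 Prop. 4.9.1 (b) p. 55] -/
theorem image_mul_valueSetMod_xPlus (σ : K →+* K) (ϖ : K) (d m : ℕ) {ξ : K} (hξ1 : Valued.v ξ = 1) :
    (fun z => ξ * z) '' valueSetMod σ ϖ m (xPlus σ ϖ d) = valueSetMod σ ϖ m (ξ • xPlus σ ϖ d) := by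
  have h := image_mul_valueSetMod_smul_xPlus σ ϖ d m 1 hξ1
  rwa [one_smul, mul_one] at h

/-- **NORM CLASS `+`** (every level): a unit `e` that is a norm has `valueSetMod σ ϖ m (e • X₊) = valueSetMod σ ϖ m X₊` (`σ` isometric). [cite: Serre1979, Ch. V §3 Cor. 3] -/
theorem valueSetMod_smul_xPlus_eq_plus_of_exists_norm {σ : K →+* K} (hvσ : ∀ a, Valued.v (σ a) = Valued.v a) (ϖ : K) (d m : ℕ)
    {e : K} (he1 : Valued.v e = 1) (h : ∃ z : K, z * σ z = e) :
    valueSetMod σ ϖ m (e • xPlus σ ϖ d) = valueSetMod σ ϖ m (xPlus σ ϖ d) := by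
  have h1 := valueSetMod_smul_xPlus_eq_of_exists_norm hvσ ϖ d m he1 (e' := 1) (by rw [map_one]) (by obtain ⟨z, hz⟩ := h; exact ⟨z, by rw [hz, inv_one, mul_one]⟩)
  rwa [one_smul] at h1

/-- **THE CLASS DICTIONARY AT THE LEVEL OF RECORD, CLASS `+`**: for a `σ`-fixed unit `e`, `valueSetMod σ ϖ m* (e • X₊) = valueSetMod σ ϖ m* X₊ ↔ e ∈ N(Eˣ)`. [cite: Serre1979, Ch. V §3 Cor. 3] -/
theorem valueSetMod_smul_xPlus_eq_plus_iff_exists_norm [IsAdicComplete 𝓂[K] 𝒪[K]] {σ : K →+* K} {ϖ : K} {d t : ℕ} (hD : IsRamifiedQuadraticDatum σ ϖ d t)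
    {e : K} (hσe : σ e = e) (he1 : Valued.v e = 1) :
    valueSetMod σ ϖ (mstarOfRecord d) (e • xPlus σ ϖ d) = valueSetMod σ ϖ (mstarOfRecord d) (xPlus σ ϖ d) ↔ ∃ z : K, z * σ z = e := by
  have h1 := valueSetMod_smul_xPlus_eq_iff_exists_norm hD hσe he1 (e' := 1) (by rw [map_one]) (by rw [map_one])
  rw [one_smul, inv_one, mul_one] at h1
  exact h1

end Scalar

/-! ## §2 THE FACE at the value-set level: a fixed NON-norm multiplier exchanges the classes `+` and `−′` (every level, no dichotomy); the one-label form at `m*` -/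

section Face

variable {K : Type} [Field K] [Valued K ℤᵐ⁰] {σ : K →+* K} {ϖ : K} {d t : ℕ}

/-- **TWO FIXED NON-NORMS HAVE A NORM QUOTIENT** (index two, ★ `isNorm_iff_not_isNorm_div`): `ξ·c⁻¹ ∈ N`. [cite: Serre1979, Ch. V §3 Cor. 3] [cite: LabesseLanglands1979, §2 p. 8] -/
theorem exists_norm_mul_inv_of_not_norm [CompleteSpace K] [Finite 𝓀[K]] (hD : IsRamifiedQuadraticDatum σ ϖ d t)
    {ξ c : K} (hσξ : σ ξ = ξ) (hξN : ¬ ∃ z : K, z * σ z = ξ) (hσc : σ c = c) (hcN : ¬ ∃ z : K, z * σ z = c) :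
    ∃ z : K, z * σ z = ξ * c⁻¹ := by
  have hξ0 : ξ ≠ 0 := fun h0 => hξN ⟨0, by rw [h0, zero_mul]⟩
  by_contra h
  rw [← div_eq_mul_inv] at h
  exact hξN ((isNorm_iff_not_isNorm_div hD hσξ hξ0 hσc hcN).2 h)

/-- **A FIXED NON-NORM TIMES A FIXED NON-NORM IS A NORM** (★ `isNorm_iff_not_isNorm_div` at `r = ξc`). [cite: Serre1979, Ch. V §3 Cor. 3] [cite: LabesseLanglands1979, §2 p. 8] -/
theorem exists_norm_mul_of_not_norm [CompleteSpace K] [Finite 𝓀[K]] (hD : IsRamifiedQuadraticDatum σ ϖ d t)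
    {ξ c : K} (hσξ : σ ξ = ξ) (hξN : ¬ ∃ z : K, z * σ z = ξ) (hσc : σ c = c) (hcN : ¬ ∃ z : K, z * σ z = c) :
    ∃ z : K, z * σ z = ξ * c := by
  have hξ0 : ξ ≠ 0 := fun h0 => hξN ⟨0, by rw [h0, zero_mul]⟩
  have hc0 : c ≠ 0 := fun h0 => hcN ⟨0, by rw [h0, zero_mul]⟩
  refine (isNorm_iff_not_isNorm_div hD (by rw [map_mul, hσξ, hσc]) (mul_ne_zero hξ0 hc0) hσc hcN).2 ?_
  rw [mul_div_cancel_right₀ ξ hc0]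
  exact hξN

/-- **THE FACE, `+ ↦ −′`** (every level `m`, no dictionary witness): if `S = valueSetMod σ ϖ m X₊` (class `+`), then `ξ·S = valueSetMod σ ϖ m (c • X₊)` (class `−′`), for `σ`-fixed
NON-norm units `ξ` (the multiplier), `c` (the `−′` representative): `ξ·S = VS(ξ • X₊)` (§1) and `ξ∕c ∈ N`. [cite: Serre1979, Ch. V §3 Cor. 3] [cite: Rogawski1990, §4.9 Prop. 4.9.1 (b) p. 55] -/
theorem image_mul_eq_valueSetMod_minus_of_eq_plus [CompleteSpace K] [Finite 𝓀[K]] (hD : IsRamifiedQuadraticDatum σ ϖ d t) (m : ℕ)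
    {ξ c : K} (hσξ : σ ξ = ξ) (hξ1 : Valued.v ξ = 1) (hξN : ¬ ∃ z : K, z * σ z = ξ) (hσc : σ c = c) (hc1 : Valued.v c = 1) (hcN : ¬ ∃ z : K, z * σ z = c)
    {S : Set K} (hS : S = valueSetMod σ ϖ m (xPlus σ ϖ d)) :
    (fun z => ξ * z) '' S = valueSetMod σ ϖ m (c • xPlus σ ϖ d) := by
  rw [hS, image_mul_valueSetMod_xPlus σ ϖ d m hξ1]
  exact valueSetMod_smul_xPlus_eq_of_exists_norm hD.2.1 ϖ d m hξ1 hc1 (exists_norm_mul_inv_of_not_norm hD hσξ hξN hσc hcN)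

/-- **THE FACE, `−′ ↦ +`** (every level `m`, no dictionary witness): if `S = valueSetMod σ ϖ m (c • X₊)` (class `−′`), then `ξ·S = valueSetMod σ ϖ m X₊` (class `+`):
`ξ·S = VS((ξc) • X₊)` and `ξ·c ∈ N`. [cite: Serre1979, Ch. V §3 Cor. 3] [cite: Rogawski1990, §4.9 Prop. 4.9.1 (b) p. 55] -/
theorem image_mul_eq_valueSetMod_plus_of_eq_minus [CompleteSpace K] [Finite 𝓀[K]] (hD : IsRamifiedQuadraticDatum σ ϖ d t) (m : ℕ)
    {ξ c : K} (hσξ : σ ξ = ξ) (hξ1 : Valued.v ξ = 1) (hξN : ¬ ∃ z : K, z * σ z = ξ) (hσc : σ c = c) (hc1 : Valued.v c = 1) (hcN : ¬ ∃ z : K, z * σ z = c)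
    {S : Set K} (hS : S = valueSetMod σ ϖ m (c • xPlus σ ϖ d)) :
    (fun z => ξ * z) '' S = valueSetMod σ ϖ m (xPlus σ ϖ d) := by
  rw [hS, image_mul_valueSetMod_smul_xPlus σ ϖ d m c hξ1]
  exact valueSetMod_smul_xPlus_eq_plus_of_exists_norm hD.2.1 ϖ d m (by rw [map_mul, hξ1, hc1, mul_one]) (exists_norm_mul_of_not_norm hD hσξ hξN hσc hcN)

/-- **THE FACE, ONE-LABEL FORM, `→`** (level of record, no dictionary witness): if `ξ·S` is the class-`+` value set at `m* = mstarOfRecord d` then `S` is NOT — else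
`VS(ξ • X₊) = VS(X₊)` at `m*`, making the non-norm `ξ` a norm (§1 dictionary). [cite: Serre1979, Ch. V §3 Cor. 3] [cite: Rogawski1990, §4.9 Prop. 4.9.1 (b) p. 55] -/
theorem not_eq_valueSetMod_plus_of_image_mul_eq_plus [CompleteSpace K] (hD : IsRamifiedQuadraticDatum σ ϖ d t)
    {ξ : K} (hσξ : σ ξ = ξ) (hξ1 : Valued.v ξ = 1) (hξN : ¬ ∃ z : K, z * σ z = ξ)
    {S : Set K} (hS' : (fun z => ξ * z) '' S = valueSetMod σ ϖ (mstarOfRecord d) (xPlus σ ϖ d)) :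
    ¬ S = valueSetMod σ ϖ (mstarOfRecord d) (xPlus σ ϖ d) := by
  intro hS
  haveI := Literature.NumberTheory.LocalFields.isAdicComplete_valuedInteger_of_completeSpace (K := K) hD.2.2.1
  rw [hS, image_mul_valueSetMod_xPlus σ ϖ d _ hξ1] at hS'
  exact hξN ((valueSetMod_smul_xPlus_eq_plus_iff_exists_norm hD hσξ hξ1).1 hS')

/-- **THE FACE, ONE-LABEL FORM, `↔`** at the level of record, GIVEN AN (A″) WITNESS for `S` (`S = valueSetMod σ ϖ m* (e • X₊)` for some `σ`-fixed unit `e` — ★ p860337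
`cleanLabelDichotomyLawAt_of_fence` on the clean shell): `ξ·S = VS_{m*}(X₊) ↔ ¬ S = VS_{m*}(X₊)`.  `←`: `e ∉ N` (else `S` would be class `+`), so `ξe ∈ N` and `ξ·S = VS((ξe) • X₊) = VS(X₊)`.
[cite: Serre1979, Ch. V §3 Cor. 3] [cite: LabesseLanglands1979, §2 p. 8] [cite: Rogawski1990, §4.9 Prop. 4.9.1 (b) p. 55] -/
theorem image_mul_eq_valueSetMod_plus_iff_not [CompleteSpace K] [Finite 𝓀[K]] (hD : IsRamifiedQuadraticDatum σ ϖ d t)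
    {ξ : K} (hσξ : σ ξ = ξ) (hξ1 : Valued.v ξ = 1) (hξN : ¬ ∃ z : K, z * σ z = ξ)
    {S : Set K} (hdich : ∃ e : K, σ e = e ∧ Valued.v e = 1 ∧ S = valueSetMod σ ϖ (mstarOfRecord d) (e • xPlus σ ϖ d)) :
    (fun z => ξ * z) '' S = valueSetMod σ ϖ (mstarOfRecord d) (xPlus σ ϖ d) ↔ ¬ S = valueSetMod σ ϖ (mstarOfRecord d) (xPlus σ ϖ d) := by
  refine ⟨not_eq_valueSetMod_plus_of_image_mul_eq_plus hD hσξ hξ1 hξN, fun hS => ?_⟩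
  haveI := Literature.NumberTheory.LocalFields.isAdicComplete_valuedInteger_of_completeSpace (K := K) hD.2.2.1
  obtain ⟨e, hσe, he1, hSe⟩ := hdich
  -- `e` is not a norm, else `S` would be the class-`+` set
  have heN : ¬ ∃ z : K, z * σ z = e := fun h => hS (by rw [hSe]; exact (valueSetMod_smul_xPlus_eq_plus_iff_exists_norm hD hσe he1).2 h)
  exact image_mul_eq_valueSetMod_plus_of_eq_minus hD _ hσξ hξ1 hξN hσe he1 heN hSe

end Face

/-! ## §3 LATTICE letters (★ census DEFS `latticeValueSetMod ∕ LatticeLabelPlus`): two vertices whose census value sets differ by the multiplier `ξ`; the glue-letter instance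
over ★ p861069 `latticeValueSetMod_glued_map_eq_image_mul` (plane-dominated glued vertices over `(B₂, w₀)` and `(ε·B₂, ε·w₀)`) -/

section Lattice

variable {K : Type} [Field K] [Valued K ℤᵐ⁰] {σ : K →+* K} {ϖ : K} {d t : ℕ}

/-- **LATTICE LETTERS, `+ ↦ −′`** (every level `m`): if the census value set of `(M′, X′)` is `ξ·` that of `(M, X)` and `(M, X)` is labelled `+`, then `(M′, X′)` carries the
class-`−′` value set `valueSetMod σ ϖ m (c • X₊)` (`ξ, c` `σ`-fixed non-norm units). [cite: Rogawski1990, §4.9 Prop. 4.9.1 (b) p. 55] [cite: Serre1979, Ch. V §3 Cor. 3] -/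
theorem latticeValueSetMod_eq_minus_of_latticeLabelPlus_of_eq_image [CompleteSpace K] [Finite 𝓀[K]] (hD : IsRamifiedQuadraticDatum σ ϖ d t) (m : ℕ)
    {ξ c : K} (hσξ : σ ξ = ξ) (hξ1 : Valued.v ξ = 1) (hξN : ¬ ∃ z : K, z * σ z = ξ) (hσc : σ c = c) (hc1 : Valued.v c = 1) (hcN : ¬ ∃ z : K, z * σ z = c)
    {M M' : Submodule 𝒪[K] (Fin 3 → K)} {X X' : Matrix (Fin 3) (Fin 3) K}
    (hS' : latticeValueSetMod σ ϖ m M' X' = (fun z => ξ * z) '' latticeValueSetMod σ ϖ m M X) (hM : LatticeLabelPlus σ ϖ d m M X) :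
    latticeValueSetMod σ ϖ m M' X' = valueSetMod σ ϖ m (c • xPlus σ ϖ d) := by
  rw [hS']
  exact image_mul_eq_valueSetMod_minus_of_eq_plus hD m hσξ hξ1 hξN hσc hc1 hcN hM

/-- **LATTICE LETTERS, `−′ ↦ +`** (every level `m`): if the census value set of `(M′, X′)` is `ξ·` that of `(M, X)` and `(M, X)` carries the class-`−′` value set, then `(M′, X′)` is
labelled `+`. [cite: Rogawski1990, §4.9 Prop. 4.9.1 (b) p. 55] [cite: Serre1979, Ch. V §3 Cor. 3] -/
theorem latticeLabelPlus_of_latticeValueSetMod_eq_minus_of_eq_image [CompleteSpace K] [Finite 𝓀[K]] (hD : IsRamifiedQuadraticDatum σ ϖ d t) (m : ℕ)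
    {ξ c : K} (hσξ : σ ξ = ξ) (hξ1 : Valued.v ξ = 1) (hξN : ¬ ∃ z : K, z * σ z = ξ) (hσc : σ c = c) (hc1 : Valued.v c = 1) (hcN : ¬ ∃ z : K, z * σ z = c)
    {M M' : Submodule 𝒪[K] (Fin 3 → K)} {X X' : Matrix (Fin 3) (Fin 3) K}
    (hS' : latticeValueSetMod σ ϖ m M' X' = (fun z => ξ * z) '' latticeValueSetMod σ ϖ m M X)
    (hM : latticeValueSetMod σ ϖ m M X = valueSetMod σ ϖ m (c • xPlus σ ϖ d)) :
    LatticeLabelPlus σ ϖ d m M' X' := by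
  show latticeValueSetMod σ ϖ m M' X' = valueSetMod σ ϖ m (xPlus σ ϖ d)
  rw [hS']
  exact image_mul_eq_valueSetMod_plus_of_eq_minus hD m hσξ hξ1 hξN hσc hc1 hcN hM

/-- **LATTICE LETTERS, ONE-LABEL FORM `↔`** at the level of record, given an (A″) witness at `(M, X)` (★ p860337 `cleanLabelDichotomyLawAt_of_fence` on the clean shell):
`LatticeLabelPlus (M′, X′) ↔ ¬ LatticeLabelPlus (M, X)`. [cite: Rogawski1990, §4.9 Prop. 4.9.1 (b) p. 55] [cite: Serre1979, Ch. V §3 Cor. 3] -/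
theorem latticeLabelPlus_iff_not_of_eq_image [CompleteSpace K] [Finite 𝓀[K]] (hD : IsRamifiedQuadraticDatum σ ϖ d t)
    {ξ : K} (hσξ : σ ξ = ξ) (hξ1 : Valued.v ξ = 1) (hξN : ¬ ∃ z : K, z * σ z = ξ)
    {M M' : Submodule 𝒪[K] (Fin 3 → K)} {X X' : Matrix (Fin 3) (Fin 3) K}
    (hS' : latticeValueSetMod σ ϖ (mstarOfRecord d) M' X' = (fun z => ξ * z) '' latticeValueSetMod σ ϖ (mstarOfRecord d) M X)
    (hdich : ∃ e : K, σ e = e ∧ Valued.v e = 1 ∧ latticeValueSetMod σ ϖ (mstarOfRecord d) M X = valueSetMod σ ϖ (mstarOfRecord d) (e • xPlus σ ϖ d)) :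
    LatticeLabelPlus σ ϖ d (mstarOfRecord d) M' X' ↔ ¬ LatticeLabelPlus σ ϖ d (mstarOfRecord d) M X := by
  show latticeValueSetMod σ ϖ (mstarOfRecord d) M' X' = valueSetMod σ ϖ (mstarOfRecord d) (xPlus σ ϖ d) ↔
    ¬ latticeValueSetMod σ ϖ (mstarOfRecord d) M X = valueSetMod σ ϖ (mstarOfRecord d) (xPlus σ ϖ d)
  rw [hS']
  exact image_mul_eq_valueSetMod_plus_iff_not hD hσξ hξ1 hξN hdich

open Summit.HodgeConjecture.HodgeConjecture.Cruxes.H413.F0P3cDyRamGlueLabelPlaneScaling (latticeValueSetMod_glued_map_eq_image_mul) in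
/-- **THE GLUE-LETTER INSTANCE (MECH (M3) ∕ the ω-cells): PLANE SCALING BY A NON-NORM EXCHANGES THE LABEL CLASSES.**  Binders of ★ p861069 `latticeValueSetMod_glued_map_eq_image_mul`
VERBATIM (two plane-dominated glued vertices `M` over `(B₂, w₀, x₀)` and `M′` over `(ε·B₂, ε·w₀, x₀′)`, same tube `b`, `ε` a `γ₂`-commuting similitude of `(E², Φ₂)` with unit
multiplier `ξ`, both line terms `ϖ^m`-small) at a complete sheet datum, plus: `ξ` is `σ`-FIXED and NOT a norm, `c` a `σ`-fixed non-norm unit.  Then, for `Γ = endoGL (γ₂, u)`: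
`LatticeLabelPlus σ ϖ d m M (Γ − 1) → latticeValueSetMod σ ϖ m M′ (Γ − 1) = valueSetMod σ ϖ m (c • X₊)` and `latticeValueSetMod σ ϖ m M (Γ − 1) = valueSetMod σ ϖ m (c • X₊) →
LatticeLabelPlus σ ϖ d m M′ (Γ − 1)` — the vertex over `ε·Λ` carries the OTHER label class. [cite: Jacobowitz1962, §4] [cite: Rogawski1990, §4.9 Prop. 4.9.1 (b) p. 55] [cite: Serre1979, Ch. V §3 Cor. 3] -/
theorem glued_labelClass_exchange_of_similitude_nonNorm [CompleteSpace K] [Finite 𝓀[K]] (hD : IsRamifiedQuadraticDatum σ ϖ d t)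
    {M M' : Submodule 𝒪[K] (Fin 3 → K)} {b : ℕ} (hpr : ∀ x ∈ M, Valued.v (x 1) * Valued.v ϖ ^ b ≤ 1) (hpr' : ∀ x ∈ M', Valued.v (x 1) * Valued.v ϖ ^ b ≤ 1)
    {B₂ : Submodule 𝒪[K] (Fin 2 → K)} {w₀ : Fin 2 → K} {x₀ x₀' : Fin 3 → K} {ε : Matrix (Fin 2) (Fin 2) K} {ξ : K}
    (hσξ : σ ξ = ξ) (hξ1 : Valued.v ξ = 1) (hξN : ¬ ∃ z : K, z * σ z = ξ)
    (hε : ∀ x y : Fin 2 → K, pairing σ ((StdForm.antidiagonal 2).over K) (ε *ᵥ x) (ε *ᵥ y) = ξ * pairing σ ((StdForm.antidiagonal 2).over K) x y)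
    (γ₂ : GL (Fin 2) K) (hεγ : ε * (γ₂ : Matrix (Fin 2) (Fin 2) K) = (γ₂ : Matrix (Fin 2) (Fin 2) K) * ε) (u : GL (Fin 1) K) (m : ℕ)
    (hB : B₂.map ((Matrix.toLin' (!![1, 0; 0, 0; 0, 1] : Matrix (Fin 3) (Fin 2) K)).restrictScalars 𝒪[K]) =
      M ⊓ LinearMap.ker ((LinearMap.proj (1 : Fin 3) : (Fin 3 → K) →ₗ[K] K).restrictScalars 𝒪[K]))
    (hB' : (B₂.map ((Matrix.toLin' ε).restrictScalars 𝒪[K])).map ((Matrix.toLin' (!![1, 0; 0, 0; 0, 1] : Matrix (Fin 3) (Fin 2) K)).restrictScalars 𝒪[K]) =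
      M' ⊓ LinearMap.ker ((LinearMap.proj (1 : Fin 3) : (Fin 3 → K) →ₗ[K] K).restrictScalars 𝒪[K]))
    (hx₀ : x₀ ∈ M) (hx₀' : x₀' ∈ M') (hx₀1 : Valued.v (x₀ 1) * Valued.v ϖ ^ b = 1) (hx₀'1 : Valued.v (x₀' 1) * Valued.v ϖ ^ b = 1)
    (hprx : x₀ - Pi.single 1 (x₀ 1) = ![w₀ 0, 0, w₀ 1]) (hprx' : x₀' - Pi.single 1 (x₀' 1) = ![(ε *ᵥ w₀) 0, 0, (ε *ᵥ w₀) 1])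
    (hline : Valued.v ((ϖ ^ m)⁻¹ * (((u : Matrix (Fin 1) (Fin 1) K) 0 0 - 1) * (σ (x₀ 1) * (1 : K) * x₀ 1))) ≤ 1)
    (hline' : Valued.v ((ϖ ^ m)⁻¹ * (((u : Matrix (Fin 1) (Fin 1) K) 0 0 - 1) * (σ (x₀' 1) * (1 : K) * x₀' 1))) ≤ 1)
    {c : K} (hσc : σ c = c) (hc1 : Valued.v c = 1) (hcN : ¬ ∃ z : K, z * σ z = c) :
    (LatticeLabelPlus σ ϖ d m M (((endoGL (γ₂, u) : GL (Fin 3) K) : Matrix (Fin 3) (Fin 3) K) - 1) →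
        latticeValueSetMod σ ϖ m M' (((endoGL (γ₂, u) : GL (Fin 3) K) : Matrix (Fin 3) (Fin 3) K) - 1) = valueSetMod σ ϖ m (c • xPlus σ ϖ d)) ∧
      (latticeValueSetMod σ ϖ m M (((endoGL (γ₂, u) : GL (Fin 3) K) : Matrix (Fin 3) (Fin 3) K) - 1) = valueSetMod σ ϖ m (c • xPlus σ ϖ d) →
        LatticeLabelPlus σ ϖ d m M' (((endoGL (γ₂, u) : GL (Fin 3) K) : Matrix (Fin 3) (Fin 3) K) - 1)) := by
  have hS' := latticeValueSetMod_glued_map_eq_image_mul σ hD.2.1 hD.2.2.1 hpr hpr' hξ1 hε γ₂ hεγ u m hB hB' hx₀ hx₀' hx₀1 hx₀'1 hprx hprx' hline hline'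
  exact ⟨latticeValueSetMod_eq_minus_of_latticeLabelPlus_of_eq_image hD m hσξ hξ1 hξN hσc hc1 hcN hS',
    latticeLabelPlus_of_latticeValueSetMod_eq_minus_of_eq_image hD m hσξ hξ1 hξN hσc hc1 hcN hS'⟩

end Lattice

/-! ## §4 M-letters (★ DEFS `levelSet ∕ levelSetDep` of the line model): the `hface` of ★ `F0P3cDyRamConeCellFlipUnits` §B DISCHARGED in exchange form from a value-set
dictionary, and the balance HEADS — `levelSetDep` cells and, in the (S4-OF-axis) shape, the AXIS cells of `levelSet … j a` -/

section LineModel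

variable {E : Type} {M : Type*} [Field E] [Valued E ℤᵐ⁰] [Field M] [Valued M ℤᵐ⁰] {σ : E →+* E} {ϖ : E} {d t : ℕ} {ρ Θ : M →+* M} {α : M}

/-- The inverse of a `σ`-fixed non-norm unit is a `σ`-fixed non-norm unit. [cite: Serre1979, Ch. V §3 Cor. 3] -/
theorem inv_fixed_unit_not_norm {ξ : E} (hσξ : σ ξ = ξ) (hξ1 : Valued.v ξ = 1) (hξN : ¬ ∃ z : E, z * σ z = ξ) :
    σ ξ⁻¹ = ξ⁻¹ ∧ Valued.v ξ⁻¹ = 1 ∧ ¬ ∃ z : E, z * σ z = ξ⁻¹ := by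
  refine ⟨by rw [map_inv₀, hσξ], by rw [map_inv₀, hξ1, inv_one], ?_⟩
  rintro ⟨z, hz⟩
  exact hξN ⟨z⁻¹, by rw [map_inv₀, ← mul_inv, hz, inv_inv]⟩

omit [Valued M ℤᵐ⁰] in
/-- **THE `hface` OF ★ §B, EXCHANGE FORM, FROM A VALUE-SET DICTIONARY.**  Plane field `E` with a complete sheet datum, line model `M`; a cell `cell ⊆ AddSubgroup M`, a symmetry
`Λ ↦ ε • Λ`, and a reading `vs : AddSubgroup M → Set E` of each member's census value set with `vs (ε • Λ) = ξ·vs Λ`, `vs (ε⁻¹ • Λ) = ξ⁻¹·vs Λ` on the cell (★ p861069: multiplication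
by `ε` is a `γ₂`-commuting similitude of multiplier `ξ`, `ε·Θε = jE ξ`), `ξ` a `σ`-fixed NON-norm unit; labels `P₁ = +` (`vs Λ = VS(X₊)`), `Q₁ = −′` (`vs Λ = VS(c • X₊)`, `c` a fixed
non-norm unit).  THEN `P₁ Λ → Q₁ (ε • Λ)` and `Q₁ Λ → P₁ (ε⁻¹ • Λ)` on the cell (§2, every level `m`). [cite: Rogawski1990, §4.9 Prop. 4.9.1 (b) p. 55] [cite: Serre1979, Ch. V §3 Cor. 3] -/
theorem face_exchange_of_valueSet_dictionary [CompleteSpace E] [Finite 𝓀[E]] (hD : IsRamifiedQuadraticDatum σ ϖ d t) (m : ℕ)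
    {ξ c : E} (hσξ : σ ξ = ξ) (hξ1 : Valued.v ξ = 1) (hξN : ¬ ∃ z : E, z * σ z = ξ) (hσc : σ c = c) (hc1 : Valued.v c = 1) (hcN : ¬ ∃ z : E, z * σ z = c)
    (cell : Set (AddSubgroup M)) (vs : AddSubgroup M → Set E) {ε : M}
    (hvs : ∀ Λ ∈ cell, vs (ε • Λ) = (fun z => ξ * z) '' vs Λ) (hvs' : ∀ Λ ∈ cell, vs (ε⁻¹ • Λ) = (fun z => ξ⁻¹ * z) '' vs Λ)
    (P₁ Q₁ : AddSubgroup M → Prop) (hP : ∀ Λ, P₁ Λ ↔ vs Λ = valueSetMod σ ϖ m (xPlus σ ϖ d)) (hQ : ∀ Λ, Q₁ Λ ↔ vs Λ = valueSetMod σ ϖ m (c • xPlus σ ϖ d)) :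
    (∀ Λ ∈ cell, P₁ Λ → Q₁ (ε • Λ)) ∧ (∀ Λ ∈ cell, Q₁ Λ → P₁ (ε⁻¹ • Λ)) := by
  obtain ⟨hσξ', hξ'1, hξ'N⟩ := inv_fixed_unit_not_norm hσξ hξ1 hξN
  refine ⟨fun Λ hΛ hPΛ => (hQ _).2 ?_, fun Λ hΛ hQΛ => (hP _).2 ?_⟩
  · rw [hvs Λ hΛ]
    exact image_mul_eq_valueSetMod_minus_of_eq_plus hD m hσξ hξ1 hξN hσc hc1 hcN ((hP Λ).1 hPΛ)
  · rw [hvs' Λ hΛ]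
    exact image_mul_eq_valueSetMod_plus_of_eq_minus hD m hσξ' hξ'1 hξ'N hσc hc1 hcN ((hQ Λ).1 hQΛ)

omit [Valued E ℤᵐ⁰] [Valued M ℤᵐ⁰] in
/-- On a cell stable under `ε⁻¹ •`, the scaling law `vs (ε • Λ) = ξ·vs Λ` gives the inverse law `vs (ε⁻¹ • Λ) = ξ⁻¹·vs Λ`. [cite: Jacobowitz1962, §4] -/
theorem valueSet_inv_smul_of_smul (cell : Set (AddSubgroup M)) (vs : AddSubgroup M → Set E) {ε : M} (hε0 : ε ≠ 0) {ξ : E} (hξ0 : ξ ≠ 0)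
    (hinv : ∀ Λ ∈ cell, ε⁻¹ • Λ ∈ cell) (hvs : ∀ Λ ∈ cell, vs (ε • Λ) = (fun z => ξ * z) '' vs Λ) :
    ∀ Λ ∈ cell, vs (ε⁻¹ • Λ) = (fun z => ξ⁻¹ * z) '' vs Λ := by
  intro Λ hΛ
  have h1 := hvs (ε⁻¹ • Λ) (hinv Λ hΛ)
  rw [smul_smul, mul_inv_cancel₀ hε0, one_smul] at h1
  rw [h1, Set.image_image]
  simp only [inv_mul_cancel_left₀ hξ0, Set.image_id']

/-- **(β₂-H) ON A DEPTH CELL, GIVEN THE VALUE-SET DICTIONARY: `#{Λ ∈ levelSetDep … ∣ +} = #{Λ ∈ levelSetDep … ∣ −′}`.**  A flip `ε` of the line model (`ε·Θε = ξM` a `ρ`-fixed unit —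
cell preservation ★ p860839 `smul_mem_levelSetDep_iff_of_flip`) whose value-set multiplier `ξ ∈ E` (`vs (ε • Λ) = ξ·vs Λ` on the cell; in the frame `ξM = jE ξ`) is a `σ`-fixed
NON-norm unit exchanges `+` and `−′` (§2), so ★ p860839 `ncard_levelSetDep_sep_eq_of_flip_exchange` balances the cell.  On TUBE cells (`a ≥ 1`) populatedness of the glue fibre
over `ε • Λ` is NOT claimed here (LH4-p09 (g9) 14:43:32Z: exact-`F` flips unpopulate at `a ≥ d`; the admissible `ε` is the (S4) instance's). [cite: Rogawski1990, §4.9 Prop. 4.9.1 (b) p. 55] [cite: Serre1979, Ch. V §3 Cor. 3] -/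
theorem ncard_levelSetDep_sep_plus_eq_sep_minus_of_valueSet_dictionary [CompleteSpace E] [Finite 𝓀[E]] (hD : IsRamifiedQuadraticDatum σ ϖ d t) (m : ℕ)
    {ξ c : E} (hσξ : σ ξ = ξ) (hξ1 : Valued.v ξ = 1) (hξN : ¬ ∃ z : E, z * σ z = ξ) (hσc : σ c = c) (hc1 : Valued.v c = 1) (hcN : ¬ ∃ z : E, z * σ z = c)
    {ε ξM : M} (hε : ε * Θ ε = ξM) (hρξ : ρ ξM = ξM) (hξM1 : Valued.v ξM = 1) (ϖE h : M) (j a : ℕ) (μ : M)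
    (vs : AddSubgroup M → Set E) (hvs : ∀ Λ ∈ levelSetDep ρ Θ α ϖE h j a μ, vs (ε • Λ) = (fun z => ξ * z) '' vs Λ)
    (P₁ Q₁ : AddSubgroup M → Prop) (hP : ∀ Λ, P₁ Λ ↔ vs Λ = valueSetMod σ ϖ m (xPlus σ ϖ d)) (hQ : ∀ Λ, Q₁ Λ ↔ vs Λ = valueSetMod σ ϖ m (c • xPlus σ ϖ d)) :
    {Λ ∈ levelSetDep ρ Θ α ϖE h j a μ | P₁ Λ}.ncard = {Λ ∈ levelSetDep ρ Θ α ϖE h j a μ | Q₁ Λ}.ncard := by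
  have hξM0 : ξM ≠ 0 := fun h0 => by rw [h0, map_zero] at hξM1; exact zero_ne_one hξM1
  have hε0 : ε ≠ 0 := ne_zero_of_mul_map_eq hε hξM0
  have hξ0 : ξ ≠ 0 := fun h0 => by rw [h0, map_zero] at hξ1; exact zero_ne_one hξ1
  have hinv : ∀ Λ ∈ levelSetDep ρ Θ α ϖE h j a μ, ε⁻¹ • Λ ∈ levelSetDep ρ Θ α ϖE h j a μ := fun Λ hΛ =>
    (smul_mem_levelSetDep_iff_of_flip (α := α) (inv_mul_map_inv_eq hε) (by rw [map_inv₀, hρξ]) (by rw [map_inv₀, hξM1, inv_one]) ϖE h j a μ Λ).2 hΛ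
  obtain ⟨hPQ, hQP⟩ := face_exchange_of_valueSet_dictionary hD m hσξ hξ1 hξN hσc hc1 hcN _ vs hvs
    (valueSet_inv_smul_of_smul _ vs hε0 hξ0 hinv hvs) P₁ Q₁ hP hQ
  exact ncard_levelSetDep_sep_eq_of_flip_exchange hε hρξ hξM1 ϖE h j a μ P₁ Q₁ hPQ hQP

/-- **(β₂-H) ON A LEVEL SET (the AXIS cells `b = 0` of MECH (M3) are `levelSet … j 0`), GIVEN THE VALUE-SET DICTIONARY, IN THE (S4-OF-axis) SHAPE of ★
`F0P3cDyRamWSideOrderCensusLabelled`: `(levelSet … j a ∩ {+}).ncard = (levelSet … j a ∩ {−′}).ncard`** — cell preservation ★ p860839 `smul_mem_levelSet_iff_of_flip`, transport ★ p860765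
`ncard_sep_eq_ncard_sep_of_equiv`, the exchange §2. [cite: Rogawski1990, §4.9 Prop. 4.9.1 (b) p. 55] [cite: Kottwitz1986BaseChangeUnits, §1 pp. 240–241] [cite: Serre1979, Ch. V §3 Cor. 3] -/
theorem ncard_levelSet_inter_plus_eq_inter_minus_of_valueSet_dictionary [CompleteSpace E] [Finite 𝓀[E]] (hD : IsRamifiedQuadraticDatum σ ϖ d t) (m : ℕ)
    {ξ c : E} (hσξ : σ ξ = ξ) (hξ1 : Valued.v ξ = 1) (hξN : ¬ ∃ z : E, z * σ z = ξ) (hσc : σ c = c) (hc1 : Valued.v c = 1) (hcN : ¬ ∃ z : E, z * σ z = c)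
    {ε ξM : M} (hε : ε * Θ ε = ξM) (hρξ : ρ ξM = ξM) (hξM1 : Valued.v ξM = 1) (ϖE h : M) (j a : ℕ)
    (vs : AddSubgroup M → Set E) (hvs : ∀ Λ ∈ levelSet ρ Θ α ϖE h j a, vs (ε • Λ) = (fun z => ξ * z) '' vs Λ)
    (P₁ Q₁ : AddSubgroup M → Prop) (hP : ∀ Λ, P₁ Λ ↔ vs Λ = valueSetMod σ ϖ m (xPlus σ ϖ d)) (hQ : ∀ Λ, Q₁ Λ ↔ vs Λ = valueSetMod σ ϖ m (c • xPlus σ ϖ d)) :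
    (levelSet ρ Θ α ϖE h j a ∩ {Λ | P₁ Λ}).ncard = (levelSet ρ Θ α ϖE h j a ∩ {Λ | Q₁ Λ}).ncard := by
  have hξM0 : ξM ≠ 0 := fun h0 => by rw [h0, map_zero] at hξM1; exact zero_ne_one hξM1
  have hε0 : ε ≠ 0 := ne_zero_of_mul_map_eq hε hξM0
  have hξ0 : ξ ≠ 0 := fun h0 => by rw [h0, map_zero] at hξ1; exact zero_ne_one hξ1
  have hinv : ∀ Λ ∈ levelSet ρ Θ α ϖE h j a, ε⁻¹ • Λ ∈ levelSet ρ Θ α ϖE h j a := fun Λ hΛ =>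
    (smul_mem_levelSet_iff_of_flip (α := α) (inv_mul_map_inv_eq hε) (by rw [map_inv₀, hρξ]) (by rw [map_inv₀, hξM1, inv_one]) ϖE h j a Λ).2 hΛ
  obtain ⟨hPQ, hQP⟩ := face_exchange_of_valueSet_dictionary hD m hσξ hξ1 hξN hσc hc1 hcN _ vs hvs
    (valueSet_inv_smul_of_smul _ vs hε0 hξ0 hinv hvs) P₁ Q₁ hP hQ
  let τ : AddSubgroup M ≃ AddSubgroup M :=
    ⟨fun Λ => ε • Λ, fun Λ => ε⁻¹ • Λ, fun Λ => by simp only [smul_smul, inv_mul_cancel₀ hε0, one_smul],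
      fun Λ => by simp only [smul_smul, mul_inv_cancel₀ hε0, one_smul]⟩
  exact ncard_sep_eq_ncard_sep_of_equiv _ τ (fun Λ => smul_mem_levelSet_iff_of_flip hε hρξ hξM1 ϖE h j a Λ) P₁ Q₁ hPQ hQP

open Summit.HodgeConjecture.HodgeConjecture.Cruxes.H413.F0P3cDyRamConeWeightHalfSplit (exists_flipUnit_of_forall_fixed_fixed_isNorm) in
/-- **HEAD — «THE β₂ FACE ON AXIS CELLS (M3)»: AN AXIS CELL IS BALANCED, `#{+} = #{−′}`, GIVEN THE VALUE-SET DICTIONARY FOR THE ω-FLIPS.**  Frame of ★ `F0P3cDyRamConeCellFlipUnits`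
§C (tower letters `jE, hvΘ, hΘj, hjfix, hjpow, hFN` of ★ `exists_flipUnit_of_forall_fixed_fixed_isNorm`: the ω-flip `ε`, `ε·Θε = jE ξ` with `ξ` a `σ`-fixed NON-norm of `E`,
EXISTS), a complete sheet datum on `E`, a `σ`-fixed non-norm unit `c` (the `−′` class), and the value-set dictionary `hvs` — for EVERY admissible ω-flip `ε` (`ε·Θε = jE ξ`, `σξ = ξ`,
`ξ ∉ N`) the census value set over `ε • Λ` is `ξ·` the one over `Λ` on the cell (★ p861069 through ★ (C) `B ↦ φ(B)`; the (S4) consumer's instance).  THEN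
`(levelSet … j a ∩ {+}).ncard = (levelSet … j a ∩ {−′}).ncard` (the axis cells are `a = 0`).  The discharge of ★ §C `ncard_levelSetDep_sep_eq_of_omegaFace`'s `hface` in the
two-label currency of (β₂-H) `N⁺ = N⁻′`. [cite: Rogawski1990, §4.9 Prop. 4.9.1 (b) p. 55] [cite: Serre1979, Ch. V §3 Cor. 3] [cite: Kottwitz1986BaseChangeUnits, §1 pp. 240–241] -/
theorem ncard_levelSet_inter_plus_eq_inter_minus_of_omegaFlip_dictionary [CompleteSpace E] [Finite 𝓀[E]] (hD : IsRamifiedQuadraticDatum σ ϖ d t) (jE : E →+* M)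
    (hvΘ : ∀ x, Valued.v (Θ x) = Valued.v x) (hΘj : ∀ x, Θ (jE x) = jE (σ x)) (hjfix : ∀ z, ρ z = z ↔ ∃ c, jE c = z)
    (hjpow : ∀ (t : E) (n : ℤ), Valued.v (jE t) = Valued.v (jE ϖ) ^ n ↔ Valued.v t = Valued.v ϖ ^ n)
    (hFN : ∀ f : M, ρ f = f → Θ f = f → Valued.v f = 1 → ∃ z : M, z * Θ z = f)
    (m : ℕ) {c : E} (hσc : σ c = c) (hc1 : Valued.v c = 1) (hcN : ¬ ∃ z : E, z * σ z = c) (ϖE h : M) (j a : ℕ)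
    (vs : AddSubgroup M → Set E)
    (hvs : ∀ (ε : M) (ξ : E), ε * Θ ε = jE ξ → σ ξ = ξ → (¬ ∃ z : E, z * σ z = ξ) →
      ∀ Λ ∈ levelSet ρ Θ α ϖE h j a, vs (ε • Λ) = (fun z => ξ * z) '' vs Λ)
    (P₁ Q₁ : AddSubgroup M → Prop) (hP : ∀ Λ, P₁ Λ ↔ vs Λ = valueSetMod σ ϖ m (xPlus σ ϖ d)) (hQ : ∀ Λ, Q₁ Λ ↔ vs Λ = valueSetMod σ ϖ m (c • xPlus σ ϖ d)) :
    (levelSet ρ Θ α ϖE h j a ∩ {Λ | P₁ Λ}).ncard = (levelSet ρ Θ α ϖE h j a ∩ {Λ | Q₁ Λ}).ncard := by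
  obtain ⟨ε, ξ, hε1, hεξ, hσξ, hξN⟩ := exists_flipUnit_of_forall_fixed_fixed_isNorm σ hD jE hvΘ hΘj hjfix hjpow hFN
  have hρξ : ρ (jE ξ) = jE ξ := (hjfix _).2 ⟨ξ, rfl⟩
  have hξM1 : Valued.v (jE ξ) = 1 := by rw [← hεξ, map_mul, hvΘ, hε1, mul_one]
  have hξ1 : Valued.v ξ = 1 := by
    have h0 := (hjpow ξ 0).1 (by rw [zpow_zero]; exact hξM1)
    rwa [zpow_zero] at h0
  exact ncard_levelSet_inter_plus_eq_inter_minus_of_valueSet_dictionary hD m hσξ hξ1 hξN hσc hc1 hcN hεξ hρξ hξM1 ϖE h j a vs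
    (hvs ε ξ hεξ hσξ hξN) P₁ Q₁ hP hQ

end LineModel

end Summit.HodgeConjecture.HodgeConjecture.Cruxes.H413.F0P3cDyRamConeCellFaceAxis

end
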